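/-
Copyright: statement-level skeleton of a published paper (lit-balaban cell, Phase-2 proof seat p25, gen 21). No proof
claims beyond what the kernel checks below.
-/
import Literature.MathematicalPhysics.QuantumFieldTheory.BalabanImbrieJaffe1984to88.BIJ88WalkLocalTermCount312
import Literature.MathematicalPhysics.QuantumFieldTheory.BalabanImbrieJaffe1984to88.BIJ88WalkLocalCountW312

/-!
# `BalabanImbrieJaffe1984to88.BIJ88WalkLocalTermCountW312` — T. Bałaban, J. Imbrie, A. Jaffe, *Effective action and
cluster properties of the abelian Higgs model*, Commun. Math. Phys. **114** (1988) 257–315 [BalabanImbrieJaffe1988],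
§5.14 p. 311–312 [PDF 55–56], verbatim: *"After sufficiently many integrations by parts, all components of X will be
complete"*, p. 310 [PDF 54] verbatim: *"It is now a standard exercise to estimate the expansion, using (5.14.4)."* and
*"The others, localized in region X, have a factor of e^{−cr(e_k)|X|}. We also consider as remainders any
terms whose order in λ and e is greater than n̄."* and (after the W₆′ estimate) *"(We allow adjustments in β, α, β′,
keeping them small.)"* — **THE LOCAL COUNT OF THE NONDEGENERATE TERMS OF THE WHOLE EXPANSION UNDER THE
WEIGHTED LOCALITY OF THE INTERACTION** (p25 gen 21; file W2, a MEMBER of row C2.Claim@312, owner r16, referee ref-5;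
head of record `BIJ88WalkIneq312RemainderBdry.ineq312_remainder_bdry` and gen 18's `BIJ88WalkLocalTermCount312`
UNCHANGED): gen 21's weighted count along a run (`BIJ88WalkLocalCountW312.run_lsum_le_W`: `Σ_{p∋u} ρ_p ≤ ρ₀`,
`Σ_p ρ_p·#{(m,j) : ⟨C_p u,(legs m)_j⟩ ≠ 0} ≤ ρ₁`, `ρ₀·rpot + ρ₁ ≤ W`) telescopes along the expansion exactly as gen
18's uniform one (`BIJ88WalkLocalTermCount312.expand_lsum_le`, the case `ρ₁ = ρ₀·N₀`):
`Σ_{t nondegenerate} Π_{X ∈ blocks ∪ remainder components} Π_{p ∈ X.pcs} ρ p ≤ W^{Φ(done,rest)}·Π_{h∈done} Π_{p∈h.pcs} ρ p`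
for `ρ₀·Φ + ρ₁ ≤ W` (`expand_lsum_le_W`), and `≤ W^{Φ₀(K)}` for the expansion of a product of observables
(`expand_lsum_init_le_W`) — the count `C = W^{Φ₀}` that feeds `BIJ88WalkRemainderActivityNC312` WITHOUT a uniform
bound on the number of vertex legs one covariance piece couples to (a volume for a non-local piece).

statement-level skeleton of published theorems with citation tags; proofs where landed; nothing here is a claim
about the Yang–Mills mass gap

PDF held: `paper:balaban1988-cmp114-bij-abelian-higgs-effective-action` (journal page = PDF page + 256); p. 310–312 =
PDF 54–56.

CITATION HEADER (lean-in-tree rule).  lit-balaban cell (HOME `run/shared/lean/pub/lit-balaban/`), Phase 2, seat p25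
gen 21; row **C2.Claim@312** of `HOME/lit-balaban-r16/ROWS-C2-part2.md` (owner r16, referee ref-5; MEMBER of the
row).  USED BY NAME, nothing restated: `BIJ88WalkTermCount312.{pot, pw, rpot_pristine_le_pot, expand_pot_key, pw_outcome}`,
`BIJ88WalkLocalCount312.nds`, `BIJ88WalkLocalCountW312.run_lsum_le_W` (p25 gen 21), `BIJ88WalkExpansionGeo311.{NondegT,
nondeg_of_oact}`, `BIJ88WalkWeights312.run_pend_dir`, `BIJ88WalkRun311`, `BIJ88WalkRunEnv311.{run_rest_subset,
run_done_le}`, `BIJ88WalkExpansion311`, `BIJ88LabelledRun311.mbind`, `BIJ88VertexComponents311.maxArity`.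

## What is proved (0 `sorry`, standard axioms, no new `Prop` facts; theorems only)

* **`expand_lsum_le_W`** (the weighted local count along the expansion), **`expand_lsum_init_le_W`** (nothing set
  aside: `Σ_{t ∈ expand 0 K, t nondegenerate} Π pw ≤ W^{Φ₀(K)}` for `W ≥ 1`, `ρ₀·Φ₀(K) + ρ₁ ≤ W`).
HONEST SCOPE: (a) locality (`ρ`, `ρ₀`, `ρ₁`) is a HYPOTHESIS in abstract weighted form — print's walks carry
`e^{−cr(e_k)|X|}`, no walk expansion is instantiated here; (b) counting only — no activity is estimated in this file;
(c) contraction-graph components.  NOT summit progress; NOT continuum; NOT Clay.  Imports `BIJ88WalkLocalTermCount312`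
(for `pot`, `pw` and their lemmas' home), `BIJ88WalkLocalCountW312`; modifies nothing.
-/

noncomputable section

namespace Literature.MathematicalPhysics.QuantumFieldTheory.BalabanImbrieJaffe1984to88.BIJ88WalkLocalTermCountW312

open Classical Matrix Finset
open scoped BigOperators
open BIJ88VertexComponents311 (maxArity)
open BIJ88LabelledRun311 (mbind)
open BIJ88WalkRun311 BIJ88WalkRunEnv311 BIJ88WalkGeometry311 BIJ88WalkExpansion311 BIJ88WalkExpansionGeo311
  BIJ88WalkWeights312 BIJ88WalkActivityShape312 BIJ88WalkTermCount312 BIJ88WalkLocalCount312 BIJ88WalkLocalCountW312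

variable {S : Type} [Fintype S] {ι : Type} [Fintype ι] {κ : Type} [LinearOrder κ] {P : Type} [Fintype P]

/-! ## The weighted local count along the expansion -/

section Expand

variable {Cov : P → Matrix S S ℝ} {trig : P → Bool} {f : S → ℝ} {c : ι → ℝ} {legs : ι → List (S → ℝ)}
  {obs : κ → List (S → ℝ)} {M : ℕ} {ρ : P → ℝ} {Dir : Set (S → ℝ)} {ρ₀ ρ₁ : ℝ}

omit [Fintype S] [Fintype ι] [LinearOrder κ] [Fintype P] in
/-- Piece weights are nonnegative for `ρ ≥ 0` (bookkeeping). [folklore] -/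
private theorem pw_nonneg' (hρ : ∀ p, 0 ≤ ρ p) (g : WGrp S κ ι P) : 0 ≤ pw ρ g :=
  Multiset.prod_nonneg fun x hx => by obtain ⟨p, -, rfl⟩ := Multiset.mem_map.1 hx; exact hρ p

omit [Fintype S] [Fintype ι] [LinearOrder κ] [Fintype P] in
/-- Products of piece weights are nonnegative (bookkeeping). [folklore] -/
private theorem prod_pw_nonneg' (hρ : ∀ p, 0 ≤ ρ p) (m : Multiset (WGrp S κ ι P)) : 0 ≤ (m.map (pw ρ)).prod :=
  Multiset.prod_nonneg fun x hx => by obtain ⟨g, -, rfl⟩ := Multiset.mem_map.1 hx; exact pw_nonneg' hρ g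

omit [Fintype S] [Fintype ι] [LinearOrder κ] [Fintype P] in
/-- Booking a block does not change nondegeneracy (bookkeeping). [folklore] -/
private theorem nondegT_addConst (g : WGrp S κ ι P) (t : WTerm S κ ι P) : NondegT (t.addConst g) ↔ NondegT t := by
  simp only [NondegT, WTerm.addConst_coef, WTerm.addConst_dirs]

/-- **THE WEIGHTED LOCAL COUNT ALONG THE EXPANSION**: observables and vertex legs with directions in `Dir`, the
pending legs of the components set aside in `Dir`; `ρ ≥ 0` with `Σ_{p : C_p u ≠ 0} ρ p ≤ ρ₀` (`u ∈ Dir`, `ρ₀ ≥ 0`) and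
the WEIGHTED locality `Σ_p ρ p·#{(m,j) : ⟨C_p u,(legs m)_j⟩ ≠ 0} ≤ ρ₁`; `W ≥ 1`, `ρ₀·Φ(done,rest) + ρ₁ ≤ W`.  Then
`Σ_{t ∈ expand done rest, t nondegenerate} Π_{X ∈ t.consts + t.groups} pw X ≤ W^{Φ(done,rest)} · Π_{h ∈ done} pw h`
(gen 18's `expand_lsum_le` is the case `ρ₁ = ρ₀·N₀`). [cite: BalabanImbrieJaffe1988, §5.14 p.310–312] -/
theorem expand_lsum_le_W (hobs : ∀ j, ∀ w ∈ obs j, w ∈ Dir) (hlegs : ∀ m, ∀ w ∈ legs m, w ∈ Dir) (hρ : ∀ p, 0 ≤ ρ p)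
    (hρ₀0 : 0 ≤ ρ₀) (hρ₀ : ∀ u ∈ Dir, (∑ p ∈ univ.filter (fun p => Cov p *ᵥ u ≠ 0), ρ p) ≤ ρ₀)
    (hρN : ∀ u ∈ Dir, (∑ p, ρ p *
      ((∑ m, ((range (legs m).length).filter fun j => (Cov p *ᵥ u) ⬝ᵥ (legs m).getD j 0 ≠ 0).card : ℕ) : ℝ)) ≤ ρ₁) :
    ∀ (n : ℕ) (done : Multiset (WGrp S κ ι P)) (rest : Finset κ), rest.card < n →
      (∀ h ∈ done, ∀ w ∈ h.pend, w ∈ Dir) → ∀ W : ℝ, 1 ≤ W →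
        ρ₀ * (pot obs M (maxArity legs) done rest : ℝ) + ρ₁ ≤ W →
          ((expand Cov trig f c legs obs M done rest).map fun t =>
              if NondegT t then ((t.consts + t.groups).map (pw ρ)).prod else 0).sum
            ≤ W ^ pot obs M (maxArity legs) done rest * (done.map (pw ρ)).prod
  | 0, _, _, hn => fun _ _ _ _ => absurd hn (Nat.not_lt_zero _)
  | n + 1, done, rest, hn => by
    intro hd W hW1 hW
    have hW0 : 0 ≤ W := zero_le_one.trans hW1
    by_cases h : rest.Nonempty
    · have hi := rest.min'_mem h
      have hRs := rpot_pristine_le_pot (P := P) (legs := legs) (obs := obs) (M := M) h done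
      obtain ⟨Φ, hΦ⟩ : ∃ Φ, Φ = pot obs M (maxArity legs) done rest := ⟨_, rfl⟩
      obtain ⟨R0, hR0⟩ : ∃ R0, R0 = rpot obs M (maxArity legs) (pristine (P := P) obs (rest.min' h))
        (rest.erase (rest.min' h)) done := ⟨_, rfl⟩
      rw [← hΦ] at hW hRs ⊢
      rw [← hR0] at hRs
      rw [expand_of_nonempty Cov trig f c legs obs M h, mbind, Multiset.map_bind, Multiset.sum_bind]
      have hpr : ∀ w ∈ (pristine (ι := ι) (P := P) obs (rest.min' h)).pend, w ∈ Dir := fun w hw => hobs _ w hw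
      -- every outcome's continuation
      have hcont : ∀ o ∈ run Cov trig f c legs obs M (pristine obs (rest.min' h)) (rest.erase (rest.min' h)) done,
          ((if o.g.IsConst M then (expand Cov trig f c legs obs M o.done o.rest).map fun t => (oact o t).addConst o.g
            else (expand Cov trig f c legs obs M (o.g ::ₘ o.done) o.rest).map (oact o)).map
              fun t => if NondegT t then ((t.consts + t.groups).map (pw ρ)).prod else 0).sum
          ≤ W ^ (Φ - R0) * (nds obs M legs ρ W o * (done.map (pw ρ)).prod) := by
        intro o ho
        have hcard : o.rest.card < n := lt_of_lt_of_le (lt_of_le_of_lt (Finset.card_le_card (run_rest_subset _ _ _ o ho))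
          (Finset.card_erase_lt_of_mem hi)) (Nat.lt_succ_iff.1 hn)
        have hpw := pw_outcome (Cov := Cov) (trig := trig) (f := f) (c := c) (M := M) ρ (rest.min' h)
          (rest.erase (rest.min' h)) done o ho
        have hle := run_rpot_le (Cov := Cov) (trig := trig) (f := f) (c := c) (legs := legs) (obs := obs) (M := M)
          _ _ _ o ho
        rw [← hR0] at hle
        have hdo : ∀ h' ∈ o.done, ∀ w ∈ h'.pend, w ∈ Dir := fun h' hh' =>
          hd h' (Multiset.mem_of_le (run_done_le _ _ _ o ho) hh')
        have hgo : ∀ w ∈ o.g.pend, w ∈ Dir := run_pend_dir hobs hlegs _ _ _ o ho hpr hd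
        by_cases hnd : Nondeg o
        swap
        · -- a degenerate outcome: every continuation term is degenerate
          rw [nds, if_neg hnd, zero_mul, mul_zero]
          refine le_of_eq (Multiset.sum_eq_zero fun x hx => ?_)
          obtain ⟨t', ht', rfl⟩ := Multiset.mem_map.1 hx
          rw [if_neg]
          intro hT
          split_ifs at ht' with hg
          · obtain ⟨t, -, rfl⟩ := Multiset.mem_map.1 ht'
            exact hnd (nondeg_of_oact ((nondegT_addConst _ _).1 hT)).1
          · obtain ⟨t, -, rfl⟩ := Multiset.mem_map.1 ht'
            exact hnd (nondeg_of_oact hT).1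
        rw [nds, if_pos hnd]
        split_ifs with hg
        · have key := expand_pot_key (P := P) h done o ho 0 (Nat.zero_le _)
          rw [← hR0, ← hΦ] at key
          rw [Multiset.map_map]
          have hb : ρ₀ * (pot obs M (maxArity legs) o.done o.rest : ℝ) + ρ₁ ≤ W :=
            le_trans (add_le_add (mul_le_mul_of_nonneg_left (by exact_mod_cast (by omega :
              pot obs M (maxArity legs) o.done o.rest ≤ Φ)) hρ₀0) le_rfl) hW
          have IH := expand_lsum_le_W hobs hlegs hρ hρ₀0 hρ₀ hρN n o.done o.rest hcard hdo W hW1 hb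
          have hpt : ∀ t ∈ expand Cov trig f c legs obs M o.done o.rest,
              ((fun t : WTerm S κ ι P => if NondegT t then ((t.consts + t.groups).map (pw ρ)).prod else 0)
                ∘ fun t => (oact o t).addConst o.g) t
                ≤ pw ρ o.g * (if NondegT t then ((t.consts + t.groups).map (pw ρ)).prod else 0) := by
            intro t _
            simp only [Function.comp_apply]
            by_cases hT : NondegT ((oact o t).addConst o.g)
            · have hT' : NondegT t := (nondeg_of_oact ((nondegT_addConst _ _).1 hT)).2
              rw [if_pos hT, if_pos hT']
              simp only [WTerm.addConst_consts, WTerm.addConst_groups, oact_consts, oact_groups, Multiset.cons_add,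
                Multiset.map_cons, Multiset.prod_cons]
              exact le_rfl
            · rw [if_neg hT]
              refine mul_nonneg (pw_nonneg' hρ _) ?_
              split_ifs
              · exact prod_pw_nonneg' hρ _
              · exact le_rfl
          calc _ ≤ ((expand Cov trig f c legs obs M o.done o.rest).map fun t =>
                  pw ρ o.g * (if NondegT t then ((t.consts + t.groups).map (pw ρ)).prod else 0)).sum :=
                Multiset.sum_map_le_sum_map _ _ hpt
            _ = pw ρ o.g * ((expand Cov trig f c legs obs M o.done o.rest).map fun t =>
                  if NondegT t then ((t.consts + t.groups).map (pw ρ)).prod else 0).sum := by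
                rw [Multiset.sum_map_mul_left]
            _ ≤ pw ρ o.g * (W ^ pot obs M (maxArity legs) o.done o.rest * (o.done.map (pw ρ)).prod) :=
                mul_le_mul_of_nonneg_left IH (pw_nonneg' hρ _)
            _ = W ^ pot obs M (maxArity legs) o.done o.rest * (pw ρ o.g * (o.done.map (pw ρ)).prod) := by ring
            _ = W ^ pot obs M (maxArity legs) o.done o.rest * ((o.dp.map ρ).prod * (done.map (pw ρ)).prod) := by
                rw [hpw]
            _ ≤ W ^ (Φ - R0 + rpot obs M (maxArity legs) o.g o.rest o.done)
                  * ((o.dp.map ρ).prod * (done.map (pw ρ)).prod) :=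
                mul_le_mul_of_nonneg_right (pow_le_pow_right₀ hW1 (by omega))
                  (mul_nonneg (Multiset.prod_nonneg fun x hx => by
                    obtain ⟨p, -, rfl⟩ := Multiset.mem_map.1 hx; exact hρ p) (prod_pw_nonneg' hρ _))
            _ = _ := by rw [pow_add]; ring
        · have key := expand_pot_key (P := P) h done o ho o.g.pend.length le_rfl
          rw [← hR0, ← hΦ] at key
          rw [Multiset.map_map]
          have hpot : pot obs M (maxArity legs) (o.g ::ₘ o.done) o.rest
              = o.g.pend.length + pot obs M (maxArity legs) o.done o.rest := by
            simp only [pot, Multiset.map_cons, Multiset.sum_cons, add_assoc]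
          have hb : ρ₀ * (pot obs M (maxArity legs) (o.g ::ₘ o.done) o.rest : ℝ) + ρ₁ ≤ W :=
            le_trans (add_le_add (mul_le_mul_of_nonneg_left (by exact_mod_cast (by omega :
              pot obs M (maxArity legs) (o.g ::ₘ o.done) o.rest ≤ Φ)) hρ₀0) le_rfl) hW
          have hd' : ∀ h' ∈ o.g ::ₘ o.done, ∀ w ∈ h'.pend, w ∈ Dir := fun h' hh' => by
            rcases Multiset.mem_cons.1 hh' with rfl | hh'
            · exact hgo
            · exact hdo h' hh'
          have IH := expand_lsum_le_W hobs hlegs hρ hρ₀0 hρ₀ hρN n (o.g ::ₘ o.done) o.rest hcard hd' W hW1 hb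
          have hpt : ∀ t ∈ expand Cov trig f c legs obs M (o.g ::ₘ o.done) o.rest,
              ((fun t : WTerm S κ ι P => if NondegT t then ((t.consts + t.groups).map (pw ρ)).prod else 0) ∘ oact o) t
                ≤ (if NondegT t then ((t.consts + t.groups).map (pw ρ)).prod else 0) := by
            intro t _
            simp only [Function.comp_apply]
            by_cases hT : NondegT (oact o t)
            · rw [if_pos hT, if_pos (nondeg_of_oact hT).2]
              simp only [oact_consts, oact_groups]
              exact le_rfl
            · rw [if_neg hT]
              split_ifs
              · exact prod_pw_nonneg' hρ _
              · exact le_rfl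
          calc _ ≤ ((expand Cov trig f c legs obs M (o.g ::ₘ o.done) o.rest).map fun t =>
                  if NondegT t then ((t.consts + t.groups).map (pw ρ)).prod else 0).sum :=
                Multiset.sum_map_le_sum_map _ _ hpt
            _ ≤ W ^ pot obs M (maxArity legs) (o.g ::ₘ o.done) o.rest * ((o.g ::ₘ o.done).map (pw ρ)).prod := IH
            _ = W ^ pot obs M (maxArity legs) (o.g ::ₘ o.done) o.rest * ((o.dp.map ρ).prod * (done.map (pw ρ)).prod) := by
                rw [Multiset.map_cons, Multiset.prod_cons, hpw]
            _ ≤ W ^ (Φ - R0 + rpot obs M (maxArity legs) o.g o.rest o.done)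
                  * ((o.dp.map ρ).prod * (done.map (pw ρ)).prod) :=
                mul_le_mul_of_nonneg_right (pow_le_pow_right₀ hW1 (by rw [hpot]; omega))
                  (mul_nonneg (Multiset.prod_nonneg fun x hx => by
                    obtain ⟨p, -, rfl⟩ := Multiset.mem_map.1 hx; exact hρ p) (prod_pw_nonneg' hρ _))
            _ = _ := by rw [pow_add]; ring
      have hrun : ρ₀ * (rpot obs M (maxArity legs) (pristine (P := P) obs (rest.min' h)) (rest.erase (rest.min' h)) done
          : ℝ) + ρ₁ ≤ W := by
        rw [← hR0]
        exact le_trans (add_le_add (mul_le_mul_of_nonneg_left (by exact_mod_cast (by omega : R0 ≤ Φ)) hρ₀0) le_rfl) hW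
      calc _ ≤ ((run Cov trig f c legs obs M (pristine obs (rest.min' h)) (rest.erase (rest.min' h)) done).attach.map
              fun o => W ^ (Φ - R0) * (nds obs M legs ρ W o.1 * (done.map (pw ρ)).prod)).sum :=
            Multiset.sum_map_le_sum_map _ _ fun o _ => hcont o.1 o.2
        _ = W ^ (Φ - R0) * (((run Cov trig f c legs obs M (pristine obs (rest.min' h)) (rest.erase (rest.min' h))
              done).map (nds obs M legs ρ W)).sum * (done.map (pw ρ)).prod) := by
            rw [← Multiset.sum_map_mul_right, ← Multiset.sum_map_mul_left, ← Multiset.attach_map_val'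
              (run Cov trig f c legs obs M (pristine obs (rest.min' h)) (rest.erase (rest.min' h)) done)]
        _ ≤ W ^ (Φ - R0) * (W ^ R0 * (done.map (pw ρ)).prod) := by
            refine mul_le_mul_of_nonneg_left (mul_le_mul_of_nonneg_right ?_ (prod_pw_nonneg' hρ _)) (pow_nonneg hW0 _)
            rw [hR0]
            exact run_lsum_le_W hobs hlegs hρ hρ₀ hρN _ _ _ _ (Nat.lt_succ_self _) hpr hd W hW1 hrun
        _ = W ^ Φ * (done.map (pw ρ)).prod := by rw [← mul_assoc, ← pow_add, Nat.sub_add_cancel hRs]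
    · rw [expand_of_not_nonempty Cov trig f c legs obs M h]
      simp only [Multiset.map_singleton, Multiset.sum_singleton, zero_add]
      split_ifs
      · exact le_mul_of_one_le_left (prod_pw_nonneg' hρ _) (one_le_pow₀ hW1)
      · exact mul_nonneg (pow_nonneg hW0 _) (prod_pw_nonneg' hρ _)

/-- **THE WEIGHTED LOCAL COUNT OF THE EXPANSION OF A PRODUCT OF OBSERVABLES** (nothing set aside):
`Σ_{t ∈ expand 0 K, t nondegenerate} Π_{X} pw X ≤ W^{Φ₀(K)}` for `W ≥ 1`, `ρ₀·Φ₀(K) + ρ₁ ≤ W`.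
[cite: BalabanImbrieJaffe1988, §5.14 p.310–312] -/
theorem expand_lsum_init_le_W (hobs : ∀ j, ∀ w ∈ obs j, w ∈ Dir) (hlegs : ∀ m, ∀ w ∈ legs m, w ∈ Dir)
    (hρ : ∀ p, 0 ≤ ρ p) (hρ₀0 : 0 ≤ ρ₀) (hρ₀ : ∀ u ∈ Dir, (∑ p ∈ univ.filter (fun p => Cov p *ᵥ u ≠ 0), ρ p) ≤ ρ₀)
    (hρN : ∀ u ∈ Dir, (∑ p, ρ p *
      ((∑ m, ((range (legs m).length).filter fun j => (Cov p *ᵥ u) ⬝ᵥ (legs m).getD j 0 ≠ 0).card : ℕ) : ℝ)) ≤ ρ₁)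
    (K : Finset κ) {W : ℝ} (hW1 : 1 ≤ W)
    (hW : ρ₀ * ((∑ j ∈ K, ((obs j).length + 1 + M * maxArity legs) : ℕ) : ℝ) + ρ₁ ≤ W) :
    ((expand Cov trig f c legs obs M 0 K).map fun t =>
        if NondegT t then ((t.consts + t.groups).map (pw ρ)).prod else 0).sum
      ≤ W ^ ∑ j ∈ K, ((obs j).length + 1 + M * maxArity legs) := by
  have h := expand_lsum_le_W (Cov := Cov) (trig := trig) (f := f) (c := c) (legs := legs) (obs := obs) (M := M)
    hobs hlegs hρ hρ₀0 hρ₀ hρN _ 0 K (Nat.lt_succ_self _) (fun h hh => absurd hh (Multiset.notMem_zero _)) W hW1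
  simp only [pot, Multiset.map_zero, Multiset.sum_zero, zero_add, Multiset.prod_zero, mul_one] at h
  exact h hW

end Expand

end Literature.MathematicalPhysics.QuantumFieldTheory.BalabanImbrieJaffe1984to88.BIJ88WalkLocalTermCountW312

end
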